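import Mathlib
import Literature.AlgebraicGeometry.Tropical.SchonIdeal
import Literature.AlgebraicGeometry.Tropical.TropicalLink
import Summits.ResolutionOfSingularities.ResolutionOfSingularities.Theorems.TropicalLinksInductiveStepWeightZero

/-!
# TropicalLinks / InductiveStep — re-embedding by constant units preserves schön-ness

Route `ResolutionOfSingularities/TropicalLinks`, crux `InductiveStep`
(stmt-ResolutionOfSingularities-17233), line `split`: brick B2 in support of stub
`stub_sncClosureSchon` (subtorus-coset reduction, Luxton–Qu §3). For a field `k`, an ideal
`I ⊆ R := k[ℤ^N]` and NONZERO CONSTANTS `c_j ∈ k`, the route's unit-graph re-embedding with the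
constant units `G_j = c_j` is `J = ⟨ι(I), y_j − c_j⟩ ⊆ S := k[ℤ^(N+m)]` (`ι : x^v ↦ x^(v,0)`,
`y_j = x^(0,e_j)`), the coset `V(I) × {c}`. We prove: **`J` is schön iff `I` is** (`IsSchonIdeal`;
`tropicalLinks_isSchonIdeal_extIdeal_const_iff`). At a weight `w = (w', w'')` with `w'' ≠ 0` some
`in_w(y_j − c_j)` is a unit monomial, so `in_w(J) = ⊤` (vacuous clause); at `w = (w', 0)`,
`in_w(J) = ⟨ι(in_{w'} I), y_j − c_j⟩` (`tropicalLinks_initialIdeal_span_eq`, via the graded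
retraction `π : S → R`, `y_j ↦ c_j`, of `ι`), whose quotient is `R ⧸ in_{w'}(I)` localized at a
unit (`tropicalLinks_extIdeal_presentation`).
-/

-- single-conjunct summit: the doubled namespace component is mandated
set_option linter.dupNamespace false

open scoped Classical
open AddMonoidAlgebra DirectSum Literature.AlgebraicGeometry.Tropical

namespace Summit.ResolutionOfSingularities.ResolutionOfSingularities.Theorems

/-- The exponents of a binomial `r x^a + s x^b` are among `a`, `b`. [folklore] -/
theorem tropicalLinks_support_binomial {k : Type*} [Semiring k] {M : Type*} {a b x : M} {r s : k}
    (hx : x ∈ (single a r + single b s : AddMonoidAlgebra k M).coeff.support) : x = a ∨ x = b := by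
  rw [coeff_add, coeff_single, coeff_single] at hx
  rcases Finset.mem_union.1 (Finsupp.support_add hx) with h | h
  · exact Or.inl (Finset.mem_singleton.1 (Finsupp.support_single_subset h))
  · exact Or.inr (Finset.mem_singleton.1 (Finsupp.support_single_subset h))

/-- The initial form of a binomial `r x^a + s x^b` with `φ a < φ b` and `r ≠ 0` is `r x^a`.
[folklore] -/
theorem tropicalLinks_initialForm_single_add_single_of_lt {k : Type*} [Semiring k] {M Λ : Type*}
    [LinearOrder Λ] (φ : M → Λ) {a b : M} (hab : φ a < φ b) {r : k} (hr : r ≠ 0) (s : k) :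
    initialForm φ (single a r + single b s) = single a r := by
  have hne : a ≠ b := fun h => hab.ne (by rw [h])
  have ha : (single a r + single b s : AddMonoidAlgebra k M).coeff a = r := by
    rw [coeff_add, coeff_single, coeff_single, Finsupp.add_apply, Finsupp.single_eq_same,
      Finsupp.single_eq_of_ne hne, add_zero]
  refine coeff_injective (Finsupp.ext fun v => ?_)
  rw [coeff_initialForm_apply, coeff_single]
  by_cases hv : v = a
  · subst hv
    rw [Finsupp.single_eq_same, if_pos (fun u hu => ?_), ha]
    rcases tropicalLinks_support_binomial hu with rfl | rfl
    exacts [le_rfl, hab.le]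
  · rw [Finsupp.single_eq_of_ne hv]
    split_ifs with hall
    · by_contra h0
      rcases tropicalLinks_support_binomial (Finsupp.mem_support_iff.2 h0) with h | rfl
      · exact hv h
      · exact (not_le.2 hab) (hall a (Finsupp.mem_support_iff.2 (by rw [ha]; exact hr)))
    · rfl

/-- A binomial `r x^a + s x^b` with `φ a = φ b` is its own initial form. [folklore] -/
theorem tropicalLinks_initialForm_single_add_single_of_eq {k : Type*} [Semiring k] {M Λ : Type*}
    [LinearOrder Λ] (φ : M → Λ) {a b : M} (hab : φ a = φ b) (r s : k) :
    initialForm φ (single a r + single b s) = single a r + single b s :=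
  initialForm_of_forall_eq fun u hu v hv => by
    have key : ∀ x ∈ (single a r + single b s : AddMonoidAlgebra k M).coeff.support, φ x = φ a :=
      fun x hx => (tropicalLinks_support_binomial hx).elim (fun h => h ▸ rfl) fun h => h ▸ hab.symm
    rw [key u hu, key v hv]

/-- A nonzero weight component of `g` has an exponent of that weight. [folklore] -/
theorem tropicalLinks_exists_of_decompose_ne_zero {k : Type*} [CommSemiring k] {M Λ : Type*}
    [AddMonoid M] [AddMonoid Λ] [DecidableEq Λ] (φ : M →+ Λ) (g : AddMonoidAlgebra k M) (i : Λ)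
    (h : ((decompose (gradeBy k φ) g i : gradeBy k φ i) : AddMonoidAlgebra k M) ≠ 0) :
    ∃ v ∈ g.coeff.support, φ v = i := by
  rw [decompose_gradeBy_coe] at h
  obtain ⟨v, hv⟩ := (Finsupp.support_nonempty_iff (f := g.coeff.filter fun m => φ m = i)).2
    fun h0 => h (by rw [h0, ofCoeff_zero])
  rw [Finsupp.support_filter, Finset.mem_filter] at hv
  exact ⟨v, hv.1, hv.2⟩

/-- The weight component of `g` through one of its exponents is nonzero. [folklore] -/
theorem tropicalLinks_decompose_ne_zero_of_mem_support {k : Type*} [CommSemiring k] {M Λ : Type*}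
    [AddMonoid M] [AddMonoid Λ] [DecidableEq Λ] (φ : M →+ Λ) (g : AddMonoidAlgebra k M) {u : M}
    (hu : u ∈ g.coeff.support) :
    ((decompose (gradeBy k φ) g (φ u) : gradeBy k φ (φ u)) : AddMonoidAlgebra k M) ≠ 0 := by
  rw [decompose_gradeBy_coe]
  exact fun h0 => (Finsupp.mem_support_iff.1 hu)
    (by simpa using congrArg (fun x : AddMonoidAlgebra k M => x.coeff u) h0)

/-- **Initial forms under a graded ring homomorphism** `F : k[M] → k[M']` (weight pieces to weight
pieces of the same weight): if `F (in_φ f) ≠ 0` then `in_{φ'}(F f) = F (in_φ f)`. [folklore] -/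
theorem tropicalLinks_initialForm_map {k : Type*} [CommSemiring k] {M M' Λ : Type*} [AddMonoid M]
    [AddMonoid M'] [AddMonoid Λ] [LinearOrder Λ] (φ : M →+ Λ) (φ' : M' →+ Λ)
    (F : gradeBy k φ →+*ᵍ gradeBy k φ') (f : AddMonoidAlgebra k M)
    (hF : F (initialForm φ f) ≠ 0) : initialForm φ' (F f) = F (initialForm φ f) := by
  have hdec : ∀ i, ((decompose (gradeBy k φ') (F f) i : gradeBy k φ' i) : AddMonoidAlgebra k M') =
      F ((decompose (gradeBy k φ) f i : gradeBy k φ i) : AddMonoidAlgebra k M) :=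
    fun i => (F.map_directSumDecompose).symm
  obtain ⟨m₀, hm₀, hmin⟩ := f.coeff.support.exists_min_image φ (Finsupp.support_nonempty_iff.2
    fun h => hF (by rw [coeff_eq_zero.1 h, initialForm_zero, map_zero]))
  have h1 : initialForm φ f = ((decompose (gradeBy k φ) f (φ m₀) : gradeBy k φ (φ m₀)) :
      AddMonoidAlgebra k M) := initialForm_eq_decompose φ hm₀ hmin
  obtain ⟨u₀, hu₀, hu₀w⟩ := tropicalLinks_exists_of_decompose_ne_zero φ' (F f) (φ m₀)
    (by rw [hdec, ← h1]; exact hF)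
  have hmin' : ∀ u ∈ (F f).coeff.support, φ' u₀ ≤ φ' u := by
    intro u hu
    have hc := tropicalLinks_decompose_ne_zero_of_mem_support φ' (F f) hu
    rw [hdec] at hc
    obtain ⟨v, hv, hvw⟩ := tropicalLinks_exists_of_decompose_ne_zero φ f (φ' u)
      (fun h0 => hc (by rw [h0, map_zero]))
    rw [hu₀w, ← hvw]
    exact hmin v hv
  rw [initialForm_eq_decompose φ' hu₀ hmin', hdec, hu₀w, ← h1]

/-- An algebra map of monoid algebras sending monomials to weighted monomials of the same weight
maps weight pieces to weight pieces. [folklore] -/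
theorem tropicalLinks_map_mem_gradeBy {k : Type*} [CommSemiring k] {M M' Λ : Type*} [AddMonoid M]
    [AddMonoid M'] (φ : M → Λ) (φ' : M' → Λ)
    (F : AddMonoidAlgebra k M →ₐ[k] AddMonoidAlgebra k M') (σ : M → M') (s : M → k)
    (hF : ∀ v, F (single v 1) = single (σ v) (s v)) (hσ : ∀ v, φ' (σ v) = φ v) {i : Λ}
    {g : AddMonoidAlgebra k M} (hg : g ∈ gradeBy k φ i) : F g ∈ gradeBy k φ' i := by
  have hg' : ∀ v ∈ g.coeff.support, φ v = i := hg
  have h0 : F g = g.coeff.sum fun v r => F (single v r) := by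
    conv_lhs => rw [← AddMonoidAlgebra.sum_coeff_single g]
    exact map_finsuppSum F g.coeff _
  rw [h0]
  refine Submodule.finsuppSum_mem k (gradeBy k φ' i) g.coeff (fun v r => F (single v r))
    fun v hv => ?_
  have h1 : single v (g.coeff v) = g.coeff v • single v (1 : k) := by rw [smul_single', mul_one]
  rw [h1, map_smul, hF v]
  refine Submodule.smul_mem _ _ ?_
  rw [← hg' v (Finsupp.mem_support_iff.2 hv), ← hσ v]
  exact single_mem_gradeBy _ _ _

/-- **Initial ideals of an extension along a graded section/retraction pair.** For graded
algebra maps `ι : k[M'] → k[M]`, `π : k[M] → k[M']` with `π ∘ ι = id` and a set `Y ⊆ k[M]` of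
`φ`-homogeneous elements killed by `π` with `g − ι(π g) ∈ ⟨Y⟩` for all `g` (`⟨Y⟩ = ker π`):
`in_φ ⟨ι(I), Y⟩ = ⟨ι(in_{φ'} I), Y⟩` for every ideal `I ⊆ k[M']`. [folklore] -/
theorem tropicalLinks_initialIdeal_span_eq {k : Type*} [CommRing k] {M M' Λ : Type*} [AddMonoid M]
    [AddMonoid M'] [AddMonoid Λ] [LinearOrder Λ] (φ : M →+ Λ) (φ' : M' →+ Λ)
    (ι : AddMonoidAlgebra k M' →ₐ[k] AddMonoidAlgebra k M)
    (π : AddMonoidAlgebra k M →ₐ[k] AddMonoidAlgebra k M')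
    (hιg : ∀ (i : Λ) (g : AddMonoidAlgebra k M'), g ∈ gradeBy k φ' i → ι g ∈ gradeBy k φ i)
    (hπg : ∀ (i : Λ) (g : AddMonoidAlgebra k M), g ∈ gradeBy k φ i → π g ∈ gradeBy k φ' i)
    (hπι : ∀ g, π (ι g) = g) (Y : Set (AddMonoidAlgebra k M)) (hY : ∀ y ∈ Y, π y = 0)
    (hYh : ∀ y ∈ Y, initialForm φ y = y) (hker : ∀ g, g - ι (π g) ∈ Ideal.span Y)
    (I : Ideal (AddMonoidAlgebra k M')) :
    initialIdeal φ (Ideal.span (ι '' (I : Set (AddMonoidAlgebra k M')) ∪ Y)) =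
      Ideal.span (ι '' (initialIdeal φ' I : Set (AddMonoidAlgebra k M')) ∪ Y) := by
  -- the graded structure of `ι` and `π`; initial forms commute with `ι`
  let ιg : gradeBy k φ' →+*ᵍ gradeBy k φ := ⟨ι.toRingHom, fun h => hιg _ _ h⟩
  let πg : gradeBy k φ →+*ᵍ gradeBy k φ' := ⟨π.toRingHom, fun h => hπg _ _ h⟩
  have hinj : Function.Injective ι := Function.LeftInverse.injective hπι
  have hιin : ∀ g, initialForm φ (ι g) = ι (initialForm φ' g) := fun g => by
    by_cases hg : g = 0
    · rw [hg, map_zero, initialForm_zero, initialForm_zero, map_zero]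
    exact tropicalLinks_initialForm_map φ' φ ιg g fun h0 => initialForm_ne_zero φ' hg
      (hinj (((rfl : ι (initialForm φ' g) = ιg _).trans h0).trans (map_zero ι).symm))
  apply le_antisymm
  · -- `⊆`: the initial form of `f ∈ J` lies in `⟨ι(in I), Y⟩`
    show Ideal.span _ ≤ _
    refine Ideal.span_le.2 ?_
    rintro _ ⟨f, hf, rfl⟩
    have hπf : π f ∈ I := by
      refine Ideal.mem_comap.1 (Ideal.span_le.2 ?_ hf)
      rintro x (⟨g, hg, rfl⟩ | hx)
      · simpa only [SetLike.mem_coe, Ideal.mem_comap, hπι] using hg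
      · simp only [SetLike.mem_coe, Ideal.mem_comap, hY x hx, Ideal.zero_mem]
    by_cases h0 : π (initialForm φ f) = 0
    · have h := hker (initialForm φ f)
      rw [h0, map_zero, sub_zero] at h
      exact Ideal.span_mono Set.subset_union_right h
    · have h : initialForm φ' (π f) = π (initialForm φ f) :=
        tropicalLinks_initialForm_map φ φ' πg f h0
      have h1 : ι (π (initialForm φ f)) ∈
          Ideal.span (ι '' (initialIdeal φ' I : Set (AddMonoidAlgebra k M')) ∪ Y) :=
        Ideal.subset_span (Or.inl ⟨_, by
          rw [← h]
          exact initialForm_mem_initialIdeal φ' hπf, rfl⟩)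
      rw [← sub_add_cancel (initialForm φ f) (ι (π (initialForm φ f)))]
      exact add_mem (Ideal.span_mono Set.subset_union_right (hker _)) h1
  · refine Ideal.span_le.2 ?_
    rintro x (⟨g, hg, rfl⟩ | hx)
    · refine Ideal.mem_comap.1 ((Ideal.span_le.2 ?_ : initialIdeal φ' I ≤ Ideal.comap ι _) hg)
      rintro _ ⟨g', hg', rfl⟩
      rw [SetLike.mem_coe, Ideal.mem_comap, ← hιin]
      exact initialForm_mem_initialIdeal φ (Ideal.subset_span (Or.inl ⟨g', hg', rfl⟩))
    · rw [SetLike.mem_coe, ← hYh x hx]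
      exact initialForm_mem_initialIdeal φ (Ideal.subset_span (Or.inr hx))

/-- **Regularity transport, constant units.** For nonzero constants `c_j`, all localizations at
primes of `k[ℤ^N] ⧸ I` are regular iff the same holds for `k[ℤ^(N+m)] ⧸ ⟨ι(I), y_j − c_j⟩` (the
route's inlined extended ideal, `G_j = c_j x^0`), which is `(k[ℤ^N] ⧸ I)[(∏ c_j)⁻¹]` by
`tropicalLinks_extIdeal_presentation`, a localization at a unit. [folklore] -/
theorem tropicalLinks_clause_iff_const :
    ∀ (k : Type) [Field k] (N m : ℕ) (I : Ideal (AddMonoidAlgebra k (Fin N → ℤ))) (c : Fin m → k), (∀ j, c j ≠ 0) → ((∀ (P : Ideal (AddMonoidAlgebra k (Fin N → ℤ) ⧸ I)) [P.IsPrime], IsRegularLocalRing (Localization.AtPrime P)) ↔ ∀ (P : Ideal (AddMonoidAlgebra k (Fin (N + m) → ℤ) ⧸ Ideal.span ((fun f : AddMonoidAlgebra k (Fin N → ℤ) => (AddMonoidAlgebra.ofCoeff (f.coeff.mapDomain fun v => Fin.append v (0 : Fin m → ℤ)) : AddMonoidAlgebra k (Fin (N + m) → ℤ))) '' (↑I :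 Set (AddMonoidAlgebra k (Fin N → ℤ))) ∪ Set.range (fun j : Fin m => AddMonoidAlgebra.single (Fin.append (0 : Fin N → ℤ) (Pi.single j (1 : ℤ))) (1 : k) - AddMonoidAlgebra.ofCoeff ((AddMonoidAlgebra.single (0 : Fin N → ℤ) (c j)).coeff.mapDomain fun v => Fin.append v (0 : Fin m → ℤ)))))) [P.IsPrime], IsRegularLocalRing (Localization.AtPrime P)) := by
  intro k _ N m I c hc
  obtain ⟨e, -, -⟩ := tropicalLinks_extIdeal_presentation k N m I
    (fun j => single (0 : Fin N → ℤ) (c j))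
    (Ideal.Quotient.mk I (∏ j, single (0 : Fin N → ℤ) (c j))) rfl
  have hx : IsUnit (Ideal.Quotient.mk I (∏ j, single (0 : Fin N → ℤ) (c j))) :=
    IsUnit.map _ (IsUnit.prod_univ_iff.2 fun j => isUnit_single (hc j).isUnit _)
  have e' := (IsLocalization.atUnit _ _ _ hx).toRingEquiv.trans e.toRingEquiv.symm
  exact ⟨fun h => tropicalLinks_forall_prime_regular_of_ringEquiv e' h,
    fun h => tropicalLinks_forall_prime_regular_of_ringEquiv e'.symm h⟩

/-- **Re-embedding by constant units changes nothing (brick B2 of `stub_sncClosureSchon`).** For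
nonzero constants `c_j ∈ k`, the route's extended ideal `J = ⟨ι(I), y_j − c_j⟩ ⊆ k[ℤ^(N+m)]`
(the coset `V(I) × {c}`) is schön iff `I` is: off `w'' = 0` some `in_w(y_j − c_j)` is a unit and
`in_w(J) = ⊤`; at `w = (w', 0)`, `in_w(J) = ⟨ι(in_{w'} I), y_j − c_j⟩` has quotient
`k[ℤ^N] ⧸ in_{w'}(I)` localized at a unit. [cite: LuxtonQu2009, §3]; [folklore] in this form. -/
theorem tropicalLinks_isSchonIdeal_extIdeal_const_iff : ∀ (k : Type) [Field k] (N m : ℕ) (I : Ideal (AddMonoidAlgebra k (Fin N → ℤ))) (c : Fin m → k), (∀ j, c j ≠ 0) → (Literature.AlgebraicGeometry.Tropical.IsSchonIdeal (Ideal.span ((fun f : AddMonoidAlgebra k (Fin N → ℤ) => (AddMonoidAlgebra.ofCoeff (f.coeff.mapDomain fun v => Fin.append v (0 : Fin m → ℤ)) : AddMonoidAlgebra k (Fin (N + m) → ℤ))) '' (↑I : Set (AddMonoidAlgebra k (Fin N → ℤ))) ∪ Set.range (fun j : Fin m => AddMonoidAlgebra.single (Fin.append (0 : Fin N → ℤ)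 (Pi.single j (1 : ℤ))) (1 : k) - AddMonoidAlgebra.ofCoeff ((AddMonoidAlgebra.single (0 : Fin N → ℤ) (c j)).coeff.mapDomain fun v => Fin.append v (0 : Fin m → ℤ))))) ↔ Literature.AlgebraicGeometry.Tropical.IsSchonIdeal I) := by
  intro k _ N m I c hc
  -- the lattice embedding `ι` as a `k`-algebra map (it agrees with the inlined term by `rfl`)
  let emb : (Fin N → ℤ) →+ (Fin (N + m) → ℤ) :=
    { toFun := fun v => Fin.append v (0 : Fin m → ℤ)
      map_zero' := funext fun i => Fin.addCases (fun i => by simp) (fun i => by simp) i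
      map_add' := fun u v => funext fun i => Fin.addCases (fun i => by simp) (fun i => by simp) i }
  let ιₐ : AddMonoidAlgebra k (Fin N → ℤ) →ₐ[k] AddMonoidAlgebra k (Fin (N + m) → ℤ) :=
    AddMonoidAlgebra.mapDomainAlgHom k k emb
  have hι : ∀ f, ιₐ f =
      AddMonoidAlgebra.ofCoeff (f.coeff.mapDomain fun v => Fin.append v (0 : Fin m → ℤ)) :=
    fun f => rfl
  have hι_single : ∀ (v : Fin N → ℤ) (r : k), ιₐ (single v r) = single (Fin.append v 0) r :=
    fun v r => by rw [mapDomainAlgHom_apply, AddMonoidAlgebra.mapDomain_single]; rfl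
  have hιC : ∀ r : k, ιₐ (single 0 r) = single 0 r := fun r => by
    rw [AddMonoidAlgebra.mapDomainAlgHom_apply, AddMonoidAlgebra.mapDomain_single, map_zero]
  suffices key : IsSchonIdeal (Ideal.span (⇑ιₐ '' (↑I : Set (AddMonoidAlgebra k (Fin N → ℤ))) ∪
      Set.range fun j : Fin m => single (Fin.append (0 : Fin N → ℤ) (Pi.single j (1 : ℤ))) (1 : k) -
        ιₐ (single 0 (c j)))) ↔ IsSchonIdeal I by
    exact key
  clear_value ιₐ
  clear emb
  obtain ⟨Y, hYdef⟩ : ∃ Y : Set _, Y = Set.range fun j : Fin m =>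
      single (Fin.append (0 : Fin N → ℤ) (Pi.single j (1 : ℤ))) (1 : k) - ιₐ (single 0 (c j)) :=
    ⟨_, rfl⟩
  rw [← hYdef]
  -- the exponents `ε j = (0, e_j)` of the new variables `y_j`
  obtain ⟨ε, hε⟩ : ∃ ε : Fin m → Fin (N + m) → ℤ, ∀ j, Fin.append 0 (Pi.single j 1) = ε j :=
    ⟨_, fun j => rfl⟩
  simp only [hε] at hYdef
  -- weights: `⟨(w', 0), v⟩ = ⟨w', v|_N⟩`, `⟨w, ε j⟩ = w_{N+j}`
  have hW2 : ∀ (w' : Fin N → ℤ) (v : Fin (N + m) → ℤ), dotWeight (Fin.append w' 0) v =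
      dotWeight w' fun i => v (Fin.castAdd m i) := fun w' v => by
    rw [dotWeight_apply, dotWeight_apply, Fin.sum_univ_add]; simp
  have hW1 : ∀ w' v : Fin N → ℤ, dotWeight (Fin.append w' (0 : Fin m → ℤ)) (Fin.append v 0) =
      dotWeight w' v := fun w' v => by rw [hW2]; simp
  have hW3 : ∀ (w : Fin (N + m) → ℤ) (j : Fin m), dotWeight w (ε j) = w (Fin.natAdd N j) :=
    fun w j => by rw [← hε, dotWeight_apply, Fin.sum_univ_add]; simp [Pi.single_apply]
  have hW0 : ∀ w : Fin (N + m) → ℤ, dotWeight w 0 = 0 := fun w => by simp [dotWeight_apply]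
  -- the evaluation `π : S → R`, `x^(a,b) ↦ (∏ c_j ^ b_j) x^a`, a retraction of `ι` killing `Y`
  have hzpow : ∀ (j : Fin m) (a b : ℤ), c j ^ (a + b) = c j ^ a * c j ^ b :=
    fun j a b => zpow_add₀ (hc j) a b
  let Θ : Multiplicative (Fin (N + m) → ℤ) →* AddMonoidAlgebra k (Fin N → ℤ) :=
    { toFun := fun v => single (fun i : Fin N => v.toAdd (Fin.castAdd m i))
        (∏ j : Fin m, c j ^ v.toAdd (Fin.natAdd N j))
      map_one' := by simp only [toAdd_one, Pi.zero_apply, zpow_zero, Finset.prod_const_one]; rfl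
      map_mul' := fun a b => by
        simp only [toAdd_mul, Pi.add_apply, hzpow, Finset.prod_mul_distrib, single_mul_single]
        rfl }
  let π : AddMonoidAlgebra k (Fin (N + m) → ℤ) →ₐ[k] AddMonoidAlgebra k (Fin N → ℤ) :=
    AddMonoidAlgebra.lift k _ (Fin (N + m) → ℤ) Θ
  have hπ_one : ∀ v : Fin (N + m) → ℤ, π (single v 1) =
      single (fun i : Fin N => v (Fin.castAdd m i)) (∏ j : Fin m, c j ^ v (Fin.natAdd N j)) :=
    fun v => (AddMonoidAlgebra.lift_single Θ v (1 : k)).trans (by rw [one_smul]; rfl)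
  clear_value π Θ
  have hπι : ∀ g, π (ιₐ g) = g := fun g => by
    refine AlgHom.congr_fun (AddMonoidAlgebra.algHom_ext (fun v => ?_) (by apply Algebra.ext_id) :
      π.comp ιₐ = AlgHom.id k _) g
    rw [AlgHom.comp_apply, AlgHom.id_apply, hι_single, hπ_one]
    simp only [Fin.append_left, Fin.append_right, Pi.zero_apply, zpow_zero, Finset.prod_const_one]
  have hπy : ∀ j : Fin m, π (single (ε j) (1 : k)) = single 0 (c j) := fun j => by
    have hpow : ∀ j', c j' ^ ε j (Fin.natAdd N j') = if j' = j then c j else 1 := fun j' => by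
      rw [← hε, Fin.append_right, Pi.single_apply]; split_ifs with h <;> simp [h]
    rw [hπ_one]
    simp only [hpow, Finset.prod_ite_eq', Finset.mem_univ, if_true]
    simp only [← hε, Fin.append_left, Pi.zero_apply]
    rfl
  -- the generators `y_j − c_j`: killed by `π`, `(w', 0)`-homogeneous of weight `0`
  have hy_form : ∀ j : Fin m, single (ε j) (1 : k) - ιₐ (single 0 (c j)) =
      single (ε j) 1 + single 0 (-(c j)) := fun j => by rw [hιC, sub_eq_add_neg, ← single_neg]
  have hY0 : ∀ y ∈ Y, π y = 0 := by
    rw [hYdef]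
    rintro _ ⟨j, rfl⟩
    simp only [map_sub, hπy, hπι, sub_self]
  have hYh : ∀ w' : Fin N → ℤ, ∀ y ∈ Y,
      initialForm (⇑(dotWeightHom (Fin.append w' (0 : Fin m → ℤ)))) y = y := by
    intro w'
    rw [hYdef]
    rintro _ ⟨j, rfl⟩
    simp only [hy_form]
    exact tropicalLinks_initialForm_single_add_single_of_eq _
      (by show dotWeight _ _ = dotWeight _ _; rw [hW3, hW0, Fin.append_right, Pi.zero_apply]) _ _
  -- `⟨Y⟩ ⊇ ker π`: the algebra maps `g ↦ [g]`, `g ↦ [ι (π g)]` to `S ⧸ ⟨Y⟩` agree on monomials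
  have hker : ∀ g, g - ιₐ (π g) ∈ Ideal.span Y := by
    have happend : ∀ v : Fin (N + m) → ℤ, Fin.append (fun i => v (Fin.castAdd m i)) 0 +
        Fin.append (0 : Fin N → ℤ) (fun j => v (Fin.natAdd N j)) = v :=
      fun v => funext fun i => Fin.addCases (fun i => by simp) (fun i => by simp) i
    have hprod : ∀ z : Fin m → ℤ, single (Fin.append (0 : Fin N → ℤ) z) (1 : k) =
        ∏ j, single (z j • ε j) (1 : k) := fun z => by
      rw [AddMonoidAlgebra.prod_single, Finset.prod_const_one]
      refine congrArg (single · (1 : k)) (funext fun i => ?_)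
      simp only [← hε]
      exact Fin.addCases (fun i => by simp) (fun i => by simp [Pi.single_apply]) i
    have hFz : ∀ (γ : AddMonoidAlgebra k (Fin (N + m) → ℤ) →ₐ[k]
        AddMonoidAlgebra k (Fin (N + m) → ℤ) ⧸ Ideal.span Y) (x₀ : Fin (N + m) → ℤ) (z : ℤ),
        (((γ : AddMonoidAlgebra k (Fin (N + m) → ℤ) →* _ ⧸ Ideal.span Y).comp
          (AddMonoidAlgebra.of k _)).comp (zpowersHom _ (Multiplicative.ofAdd x₀)))
            (Multiplicative.ofAdd z) = γ (single (z • x₀) 1) := fun γ x₀ z => by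
      simp only [MonoidHom.comp_apply, zpowersHom_apply, toAdd_ofAdd, AddMonoidAlgebra.of_apply,
        MonoidHom.coe_coe, toAdd_zpow]
    have hαβ : Ideal.Quotient.mkₐ k (Ideal.span Y) =
        (Ideal.Quotient.mkₐ k (Ideal.span Y)).comp (ιₐ.comp π) := by
      refine AddMonoidAlgebra.algHom_ext (fun v => ?_) (by apply Algebra.ext_id)
      have hz : ∀ (j : Fin m) (z : ℤ),
          Ideal.Quotient.mkₐ k (Ideal.span Y) (single (z • ε j) (1 : k)) =
            ((Ideal.Quotient.mkₐ k _).comp (ιₐ.comp π)) (single (z • ε j) (1 : k)) := by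
        intro j z
        rw [← hFz (Ideal.Quotient.mkₐ k _), ← hFz ((Ideal.Quotient.mkₐ k _).comp (ιₐ.comp π))]
        refine DFunLike.congr_fun (MonoidHom.ext_mint ?_) _
        rw [hFz, hFz, one_smul, AlgHom.comp_apply, AlgHom.comp_apply, Ideal.Quotient.mkₐ_eq_mk,
          Ideal.Quotient.eq, hπy]
        exact Ideal.subset_span (by rw [hYdef]; exact ⟨j, rfl⟩)
      have hv : single v (1 : k) = ιₐ (single (fun i => v (Fin.castAdd m i)) 1) *
          single (Fin.append 0 fun j => v (Fin.natAdd N j)) 1 := by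
        rw [hι_single, single_mul_single, mul_one, happend]
      show Ideal.Quotient.mkₐ k (Ideal.span Y) (single v 1) =
        Ideal.Quotient.mkₐ k (Ideal.span Y) (ιₐ (π (single v 1)))
      rw [hv]
      simp only [map_mul, hπι, hprod, map_prod]
      exact congrArg _ (Finset.prod_congr rfl fun j _ => hz j _)
    exact fun g => Ideal.Quotient.eq.1 (AlgHom.congr_fun hαβ g)
  -- (B) the key identity `in_{(w',0)}(J) = ⟨ι(in_{w'} I), Y⟩` and the equivalence of clauses
  have hkey : ∀ w' : Fin N → ℤ, weightInitialIdeal (Fin.append w' (0 : Fin m → ℤ))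
      (Ideal.span (⇑ιₐ '' (↑I : Set (AddMonoidAlgebra k (Fin N → ℤ))) ∪ Y)) = Ideal.span
        (⇑ιₐ '' (↑(weightInitialIdeal w' I) : Set (AddMonoidAlgebra k (Fin N → ℤ))) ∪ Y) :=
    fun w' => tropicalLinks_initialIdeal_span_eq (dotWeightHom (Fin.append w' (0 : Fin m → ℤ)))
      (dotWeightHom w') ιₐ π
      (fun i g hg => tropicalLinks_map_mem_gradeBy _ _ ιₐ (fun v => Fin.append v (0 : Fin m → ℤ))
        (fun _ => 1) (fun v => hι_single v 1) (fun v => hW1 w' v) hg)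
      (fun i g hg => tropicalLinks_map_mem_gradeBy _ _ π (fun v i => v (Fin.castAdd m i))
        (fun v => ∏ j : Fin m, c j ^ v (Fin.natAdd N j)) hπ_one (fun v => (hW2 w' v).symm) hg)
      hπι Y hY0 (hYh w') hker I
  have hB : ∀ w' : Fin N → ℤ,
      (∀ (P : Ideal (AddMonoidAlgebra k (Fin N → ℤ) ⧸ weightInitialIdeal w' I)) [P.IsPrime],
        IsRegularLocalRing (Localization.AtPrime P)) ↔
      ∀ (P : Ideal (AddMonoidAlgebra k (Fin (N + m) → ℤ) ⧸ weightInitialIdeal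
        (Fin.append w' (0 : Fin m → ℤ))
          (Ideal.span (⇑ιₐ '' (↑I : Set (AddMonoidAlgebra k (Fin N → ℤ))) ∪ Y)))) [P.IsPrime],
        IsRegularLocalRing (Localization.AtPrime P) := by
    intro w'
    refine (tropicalLinks_clause_iff_const k N m (weightInitialIdeal w' I) c hc).trans
      (tropicalLinks_forall_prime_regular_congr ?_)
    rw [hkey w']
    simp only [← hι]
    rw [hYdef]
    simp only [hε]
  constructor
  · exact fun hJ w' => (hB w').2 (hJ (Fin.append w' (0 : Fin m → ℤ)))
  intro hI w
  by_cases hw : ∀ j : Fin m, w (Fin.natAdd N j) = 0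
  · obtain ⟨w', rfl⟩ : ∃ w' : Fin N → ℤ, w = Fin.append w' (0 : Fin m → ℤ) :=
      ⟨fun i => w (Fin.castAdd m i),
        funext fun i => Fin.addCases (fun i => by simp) (fun j => by simp [hw j]) i⟩
    exact (hB w').1 (hI w')
  -- (A) some `y_j` has nonzero weight: `in_w(y_j − c_j)` is a unit monomial, `in_w(J) = ⊤`
  obtain ⟨j, hj⟩ := not_forall.1 hw
  have hin : initialForm (dotWeight w) (single (ε j) (1 : k) + single 0 (-(c j))) ∈
      weightInitialIdeal w (Ideal.span (⇑ιₐ '' (↑I : Set (AddMonoidAlgebra k (Fin N → ℤ))) ∪ Y)) :=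
    initialForm_mem_initialIdeal _
      (by rw [← hy_form]; exact Ideal.subset_span (Or.inr (by rw [hYdef]; exact ⟨j, rfl⟩)))
  have htop : weightInitialIdeal w
      (Ideal.span (⇑ιₐ '' (↑I : Set (AddMonoidAlgebra k (Fin N → ℤ))) ∪ Y)) = ⊤ := by
    rcases lt_or_gt_of_ne hj with hlt | hgt
    · rw [tropicalLinks_initialForm_single_add_single_of_lt (dotWeight w)
        (by rw [hW3, hW0]; exact hlt) one_ne_zero] at hin
      exact Ideal.eq_top_of_isUnit_mem _ hin (isUnit_single isUnit_one _)
    · rw [(add_comm _ _ : single (ε j) (1 : k) + _ = _),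
        tropicalLinks_initialForm_single_add_single_of_lt (dotWeight w)
          (by rw [hW3, hW0]; exact hgt) (neg_ne_zero.2 (hc j))] at hin
      exact Ideal.eq_top_of_isUnit_mem _ hin (isUnit_single (neg_ne_zero.2 (hc j)).isUnit _)
  intro P hP
  haveI := Ideal.Quotient.subsingleton_iff.2 htop
  exact absurd (Subsingleton.elim _ _) hP.ne_top

end Summit.ResolutionOfSingularities.ResolutionOfSingularities.Theorems
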